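import Summits.Schanuel.Statement
import Literature.NumberTheory.Transcendental.OneMotiveToric

/-!
# Schanuel / ToricPeriods — assembly through the toric 1-motive object

Route `Schanuel/ToricPeriods`, item `stmt-Schanuel-0468` (assembly, motivic form): with
Bertolin's equivalence `toricPeriodConjecture_iff_schanuel` (Bertolin 2002, Cor. 1.3) as a
hypothesis, André's generalised period conjecture for all toric 1-motives `[ℤʳ → 𝔾ₘⁿ]`
implies Schanuel's conjecture. The right-hand side of the named fact is verbatim
`Literature.Periods.SchanuelConjecture`, so the proof is definitional unfolding.
-/

namespace Literature.Periods

/-- Settles `stmt-Schanuel-0468` (assembly, motivic form): given Bertolin's equivalence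
`ToricPeriodConjecture ↔ SchanuelConjecture` (Bertolin 2002, Cor. 1.3) as a hypothesis, the
generalised period conjecture for all toric 1-motives implies `Schanuel`. Trivial: the
right-hand side of `toricPeriodConjecture_iff_schanuel` is syntactically
`Literature.Periods.SchanuelConjecture`. [folklore] -/
theorem toricPeriodConjecture_iff_schanuel_imp_toric_imp_schanuel :
    Literature.NumberTheory.Transcendental.toricPeriodConjecture_iff_schanuel → Literature.NumberTheory.Transcendental.ToricPeriodConjecture → Schanuel :=
  fun h hT => h.1 hT

/-! ### The converse comparison: Schanuel ⇒ thesis X (`stmt-Schanuel-0081`)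

The route thesis X ("André's GPC for `[ℤⁿ → 𝔾ₘ]/ℚ(eˣ)`": for `(2πi, x₁, …, xₙ)` `ℚ`-linearly
independent, `trdeg_ℚ ℚ(2πi, x, eˣ) ≥ n + 1`) is Schanuel's conjecture applied to the tuple
`(2πi, x₁, …, xₙ)`, using `e^{2πi} = 1` (Bertolin 2002, §3). Recorded here (refuter, kill
criterion of the route: X ⟺ Schanuel, so only a Schanuel counterexample refutes X). -/

open Complex in
/-- The field generated by the tuple `(2πi, x)` and its exponentials `(1, eˣ)` is the field
generated by `2πi`, `x` and `eˣ` (the exponential `e^{2πi} = 1` is redundant). [folklore] -/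
theorem adjoin_periods_cons_two_pi_I (n : ℕ) (x : Fin n → ℂ) :
    IntermediateField.adjoin ℚ (Set.range (Fin.cons (2 * ↑Real.pi * I) x : Fin (n + 1) → ℂ) ∪
        Set.range (cexp ∘ (Fin.cons (2 * ↑Real.pi * I) x : Fin (n + 1) → ℂ))) =
      IntermediateField.adjoin ℚ (insert (2 * ↑Real.pi * I) (Set.range x ∪ Set.range (cexp ∘ x))) := by
  rw [Fin.comp_cons, Fin.range_cons, Fin.range_cons, Complex.exp_two_pi_mul_I]
  apply le_antisymm
  · rw [IntermediateField.adjoin_le_iff]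
    rintro z (hz | hz)
    · rcases hz with rfl | hz
      · exact IntermediateField.subset_adjoin _ _ (Set.mem_insert _ _)
      · exact IntermediateField.subset_adjoin _ _ (Set.mem_insert_of_mem _ (Or.inl hz))
    · rcases hz with rfl | hz
      · exact one_mem _
      · exact IntermediateField.subset_adjoin _ _ (Set.mem_insert_of_mem _ (Or.inr hz))
  · apply IntermediateField.adjoin.mono
    rintro z (rfl | hz | hz)
    · exact Or.inl (Set.mem_insert _ _)
    · exact Or.inl (Set.mem_insert_of_mem _ hz)
    · exact Or.inr (Set.mem_insert_of_mem _ hz)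

/-- Transcendence degree over `ℚ` of equal intermediate fields of `ℂ/ℚ` agree (transport lemma:
the `ℚ`-algebra instance on `↥K` in `SchanuelConjecture` is `DivisionRing.toRatAlgebra`, whose
`CharZero` argument depends on `K`, so a plain `rw` along `K = K'` is not motive-correct). [folklore] -/
theorem trdeg_congr_of_eq {K K' : IntermediateField ℚ ℂ} (h : K = K') :
    Algebra.trdeg ℚ K = Algebra.trdeg ℚ K' := by
  subst h; rfl

/-- **Schanuel ⇒ X** (converse of the route assembly `stmt-Schanuel-0082`; Bertolin 2002, §3):
Schanuel's conjecture implies André's generalised period conjecture for the toric 1-motive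
`[ℤⁿ → 𝔾ₘ]/ℚ(eˣ)`, i.e. `trdeg_ℚ ℚ(2πi, x, eˣ) ≥ n + 1` whenever `(2πi, x)` is `ℚ`-linearly
independent: apply Schanuel to `(2πi, x₁, …, xₙ)` and discard `e^{2πi} = 1`. Hence X is
equivalent to Schanuel and can only be refuted by a counterexample to Schanuel.
[cite: Bertolin2002, §3] -/
theorem schanuel_imp_toric_gpc_thesis :
    Schanuel → ∀ (n : ℕ) (x : Fin n → ℂ), LinearIndependent ℚ (Fin.cons (2 * ↑Real.pi * Complex.I) x) → ((n + 1 : ℕ) : Cardinal) ≤ Algebra.trdeg ℚ ↥(IntermediateField.adjoin ℚ (insert (2 * ↑Real.pi * Complex.I) (Set.range x ∪ Set.range (Complex.exp ∘ x)))) := by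
  intro hS n x hx
  -- NB: `hS (n + 1) (Fin.cons (2 * ↑Real.pi * I) x) hx` (un-ascribed `↑Real.pi`) hits a `whnf`
  -- heartbeat timeout; let unification supply the tuple from `hx` instead.
  have h := hS (n + 1) _ hx
  exact h.trans_eq (trdeg_congr_of_eq (adjoin_periods_cons_two_pi_I n x))

end Literature.Periods
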